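import Summits.QuantumFields.YangMills.Theses.UnitScaleTilt
import Literature.MathematicalPhysics.QuantumFieldTheory.Balaban1983to89.T3SplitLog
import Literature.MathematicalPhysics.QuantumFieldTheory.Balaban1983to89.T3UpperLiftSplitLog
import Literature.MathematicalPhysics.QuantumFieldTheory.Balaban1983to89.T3ExistSplit
import Summits.QuantumFields.YangMills.Theorems.UnitScaleTiltMinimiserStabilityRegPrAvgActionDefect
import Summits.QuantumFields.YangMills.Theorems.UnitScaleTiltMinimiserStabilityRegPrAvgCurvGrad
import Summits.QuantumFields.YangMills.Theorems.UnitScaleTiltMinimiserStabilityRegPrSmoothLift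
import Summits.QuantumFields.YangMills.Theorems.UnitScaleTiltMinimiserStabilityRegPrCritCurvGradLog
import Summits.QuantumFields.YangMills.Theorems.UnitScaleTiltMinimiserStabilityRegPrAttainmentOfExistence
import HarnessLib

/-!
# Route `UnitScaleTilt`, crux K1 «MinimiserStabilityRegPr» (stmt-QuantumFields-19200, skeleton v9 of record) — **THE ROUTE DECL BY NAME FROM TWO OF v9's FOUR
# STUBS: `MinimiserStabilityRegPr ⇐ ⟨stub_halvingStep⟩ ∧ ⟨stub_existenceMinimalOrbit⟩` (+ the landed V4′, smooth-lift, avg-curvature-gradient and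
# avg-action-defect theorems) — the kernel certificate that v9's rows `stub_PV3A` ([Balaban1985RegularSpaces] Thm 2 on T_η, XL) and `stub_PV3Cuniq`
# ([Balaban1985Variational] Prop. 6 uniqueness) are IDLE in the v9 composition**

Cell `ym3-torus` (HUMAN RULING D-0037, YM ladder rung R3), width seat `ym-ust-20520-w4` (g0).  THEOREMS ONLY (0 `def`, 0 `sorry`, standard axioms); CONDITIONAL composition
(both remaining stubs are hypotheses, stated as their registered texts VERBATIM); `--supports stmt-QuantumFields-19200 --as helper`; registry untouched.

WHY.  v9's `MinimiserStabilityRegPr_of` (OWNER pen `plan-g24/birth_v9.lean` 33b3e71f6fbd2e5d) consumes V3 = `Prop7From14At` (clause (i) «at most one critical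
orbit» ∧ clause (ii) «a minimal orbit from a background») ONLY through ★p2's `Variational.minSixAttainedAt_of_prop7_prop8`, whose proof reads clause (ii) alone; the
sibling `…AttainmentOfExistence` re-derives that step from clause (ii) = `stub_existenceMinimalOrbit` (§3 there).  This file is v9's §2–§3 VERBATIM with that one
substitution: `variational_of_halvingStep_of_existence` (the variational data: attainment over (6), minimisers in (8), the log-Lipschitz curvature gradient of critical
configurations — `CritCurvGradLog.stub_critCurvGradLog`, p511133) and ★★ `MinimiserStabilityRegPr_of_halvingStep_of_existence` (EXIST by
`T3ExistSplit.hasRegMinimisersPrAt_of_attained`, UPPER by `T3UpperLiftSplitLog.upperAlongRegPrMinimisersAt_of_splitLog'` with `SmoothLift.stub_smoothLift` (p466834),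
LOWER by `T3SplitLog.lowerAlongRegPrMinimisersAt_of_splitLog'''` with `AvgCurvGrad.stub_avgCurvGrad` (p440643) and `AvgActionDefect.stub_avgActionDefect` (p437535), then
`minimiserStabilityRegPrAt_of_alongRegPrMinimisers`; `ε₁ := min` of three, `m₀ := 10`, `γ₁ := min` of three).
CONSEQUENCE OFFERED TO THE OWNER (no registry write): a v10 = v9 ∖ {`stub_PV3A`, `stub_PV3Cuniq`, `prop7From14_v9`} closes the crux by the same composition;
[Balaban1985RegularSpaces] Thm 2 on T_η (W-19200-T2 ∕ G-B9-LETTERS) and Prop. 6's uniqueness serve print's clause (i) only, which no R3 composition reads.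

HONEST FRAMING.  Nothing of [Balaban1985Variational] is asserted or proved; H (Sect. F halving) and EX (Prop. 7's existence clause from a background) stay
hypotheses; the crux, V3 and R3 stay OPEN; no count moves; YM₃ on T³ is ladder rung R3 — not d = 4, not infinite volume, not a mass gap, not the Clay problem.

References: T. Bałaban, CMP **102** (1985) 277–309 [Balaban1985Variational] (Thm 1 (6)–(10) pp.278–279, Prop. 7 p.299, Prop. 8 ∕ Sect. F p.304); C. King, CMP
**102** (1986) 649–677 [King1986] ((A.5) p.676); T. Bałaban, CMP **98** (1985) 17–51 [Balaban1985Averaging] (Prop. 3 (122)–(123) p.36); P. Federbush, CMP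
**110** (1987) 293–309 [Federbush1987PhaseCellIII] (Thm 4.3 (4.5) p.299).
-/

set_option autoImplicit false

noncomputable section

namespace Summit.QuantumFields.YangMills.Theorems.AttainmentOfExistence

open MeasureTheory Filter Topology
open scoped Matrix.Norms.L2Operator
open Literature.MathematicalPhysics.QuantumFieldTheory.Balaban1983to89
open Literature.MathematicalPhysics.QuantumFieldTheory.Balaban1983to89.T3ContinuumYM3Torus
open Literature.MathematicalPhysics.QuantumFieldTheory.Balaban1983to89.T3UnitLawDensityEML (ℰp measurableE_ℰp)
open Literature.MathematicalPhysics.QuantumFieldTheory.Balaban1983to89.T3UnitScaleTilt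
open Literature.MathematicalPhysics.QuantumFieldTheory.Balaban1983to89.T3TiltDescent
open Literature.MathematicalPhysics.QuantumFieldTheory.Balaban1983to89.T3CruxEstimates
open Literature.MathematicalPhysics.QuantumFieldTheory.Balaban1983to89.T3ConstrainedMinimiser
open Literature.MathematicalPhysics.QuantumFieldTheory.Balaban1983to89.T3DescentFibreTower
open Literature.MathematicalPhysics.QuantumFieldTheory.Balaban1983to89.T3MinimiserStabilityReduction
open Literature.MathematicalPhysics.QuantumFieldTheory.Balaban1983to89.T3RegularMinimiser
open Literature.MathematicalPhysics.QuantumFieldTheory.Balaban1983to89.T3PrintedRegularMinimiser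
open Literature.MathematicalPhysics.QuantumFieldTheory.Balaban1983to89.T3PrintedRegularMinimiserReduction
open Literature.MathematicalPhysics.QuantumFieldTheory.Balaban1983to89.T3PrintedMinimiserExistence
open Literature.MathematicalPhysics.QuantumFieldTheory.Balaban1983to89.T3LowerAlongMinimisersSplit
open Literature.MathematicalPhysics.QuantumFieldTheory.Balaban1983to89.T3AvgDivergenceSplit
open Literature.MathematicalPhysics.QuantumFieldTheory.Balaban1983to89.T3UpperAlongMinimisersSplit
open Literature.MathematicalPhysics.QuantumFieldTheory.Balaban1983to89.T3UpperLiftSplit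
open Literature.MathematicalPhysics.QuantumFieldTheory.Balaban1983to89.T3LowerActionSplit
open Literature.MathematicalPhysics.QuantumFieldTheory.Balaban1983to89.T3ExistSplit
open Literature.MathematicalPhysics.QuantumFieldTheory.Balaban1983to89.T3Thm1Carrier
open Literature.MathematicalPhysics.QuantumFieldTheory.Balaban1983to89.T3CurvGradLog
open Literature.MathematicalPhysics.QuantumFieldTheory.Balaban1983to89.T3SplitLog
open Literature.MathematicalPhysics.QuantumFieldTheory.Balaban1983to89.T3UpperLiftSplitLog
open Literature.MathematicalPhysics.QuantumFieldTheory.Balaban1983to89.B11 (Prop8Printed)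

/-! ## §1 The variational data from `stub_halvingStep` ∧ `stub_existenceMinimalOrbit` (+ landed V4′) -/

/-- **THE VARIATIONAL DATA FROM TWO STUBS** (v9's `variational_of_leaves_log` with V3 replaced by its existence clause): attainment over (6) and «minimisers lie in (8)»
from the sibling's `attained_in8_of_halvingStep_of_existence`, the log-Lipschitz minimiser schema from the landed V4′ (`CritCurvGradLog.stub_critCurvGradLog`, proved for
every (8)-regular configuration) and V2 (`minimiserCurvGradLogAt_of_crit`). [cite: Balaban1985Variational, Thm 1 p.279, Prop. 7 p.299, Prop. 8 p.304] -/
theorem variational_of_halvingStep_of_existence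
    (hV2 : ∀ (L : ℕ), 1 < L → ∃ B₃ : ℝ, 4 < B₃ ∧ ∃ a₅ : ℝ, 0 < a₅ ∧
      ∀ (i : Idx L) (ε₀ ε₁ : ℝ), 0 < ε₁ → ∀ (V : (famX L i).Bdry) (U : (famX L i).Cfg), (famX L i).Reg7 ε₁ V → (famX L i).InU ε₀ U →
        (famX L i).InB V U → (famX L i).IsCritical V U → ε₀ ≤ a₅ → (famX L i).InU (max (B₃ * ε₁) (ε₀ / 2)) U)
    (hEX : ∀ (L : ℕ), 1 < L → ∀ (B₃ : ℝ), 4 < B₃ → ∃ a₁' O₁ : ℝ, 0 < a₁' ∧ 1 ≤ O₁ ∧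
      ∀ (F : T3Family), F.L = L → ∀ (n K : ℕ) (hnK : n < K) (ε₁ : ℝ), 0 < ε₁ →
        ∀ V : GaugeField (F.P n) 0 (Matrix.specialUnitaryGroup (Fin 2) ℂ), PlaqSmall ε₁ V →
          ∀ U₀ : GaugeField (F.P K) 0 (Matrix.specialUnitaryGroup (Fin 2) ℂ), RegPr F n K ((L : ℝ) ^ 3 * B₃ * ε₁) U₀ → U₀ ∈ fibre F ℰp n K hnK.le V →
            ε₁ ≤ a₁' → ∃ U ∈ regFibrePr F n K hnK.le (O₁ * (L : ℝ) ^ 3 * B₃ * ε₁) V,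
              IsMinOn (fun W : GaugeField (F.P K) 0 (Matrix.specialUnitaryGroup (Fin 2) ℂ) => wilsonAction4 W)
                (regFibrePr F n K hnK.le (O₁ * (L : ℝ) ^ 3 * B₃ * ε₁) V) U)
    (L : ℕ) (hL : 1 < L) :
    ∃ â₀ â₁ a₀ a₁ B₃ B₄ : ℝ, 0 < â₀ ∧ 0 < â₁ ∧ 0 < a₀ ∧ 0 < a₁ ∧ 0 < B₃ ∧ 0 < B₄ ∧
      MinSixAttainedAt L â₀ â₁ B₃ ∧ MinimisersIn8At L a₀ a₁ B₃ ∧ MinimiserCurvGradLogAt L a₀ a₁ B₃ B₄ := by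
  obtain ⟨â₀, â₁, a₅, B₃, hâ₀, hâ₁, ha₅, hB₃, -, hatt, h8'⟩ := attained_in8_of_halvingStep_of_existence hV2 hEX L hL
  obtain ⟨a₁, B₄, ha₁, hB₄, hc⟩ := Summit.QuantumFields.YangMills.Theorems.CritCurvGradLog.stub_critCurvGradLog L hL B₃ hB₃
  have hB₃0 : 0 < B₃ := by linarith
  exact ⟨â₀, â₁, a₅, a₁, B₃, B₄, hâ₀, hâ₁, ha₅, ha₁, hB₃0, hB₄, hatt, h8' a₁, minimiserCurvGradLogAt_of_crit hB₃0 hc (h8' a₁)⟩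

/-! ## §2 ★★ The route decl by name from the two stubs -/

/-- ★★ **`MinimiserStabilityRegPr ⇐ ⟨stub_halvingStep⟩ ∧ ⟨stub_existenceMinimalOrbit⟩`** (+ the landed `SmoothLift.stub_smoothLift`, `AvgCurvGrad.stub_avgCurvGrad`,
`AvgActionDefect.stub_avgActionDefect`, `CritCurvGradLog.stub_critCurvGradLog`, `Prop8Iter`): v9's composition `MinimiserStabilityRegPr_of` VERBATIM over §1 — EXIST by
`T3ExistSplit.hasRegMinimisersPrAt_of_attained`, UPPER by `T3UpperLiftSplitLog.upperAlongRegPrMinimisersAt_of_splitLog'`, LOWER by `T3SplitLog.lowerAlongRegPrMinimisersAt_of_splitLog'''`,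
then `minimiserStabilityRegPrAt_of_alongRegPrMinimisers`; `ε₁ := min` of three, `m₀ := 10`, `γ₁ := min` of three; `L ≤ 1` vacuous.  The hypotheses are the REGISTERED texts of
v9's `stub_halvingStep` and `stub_existenceMinimalOrbit` VERBATIM; v9's `stub_PV3A`, `stub_PV3Cuniq` do not enter.
[cite: Balaban1985Variational, Thm 1 (6)-(10) pp.278-279, Prop. 7 p.299, Prop. 8 p.304] -/
theorem MinimiserStabilityRegPr_of_halvingStep_of_existence
    (hV2 : ∀ (L : ℕ), 1 < L → ∃ B₃ : ℝ, 4 < B₃ ∧ ∃ a₅ : ℝ, 0 < a₅ ∧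
      ∀ (i : Idx L) (ε₀ ε₁ : ℝ), 0 < ε₁ → ∀ (V : (famX L i).Bdry) (U : (famX L i).Cfg), (famX L i).Reg7 ε₁ V → (famX L i).InU ε₀ U →
        (famX L i).InB V U → (famX L i).IsCritical V U → ε₀ ≤ a₅ → (famX L i).InU (max (B₃ * ε₁) (ε₀ / 2)) U)
    (hEX : ∀ (L : ℕ), 1 < L → ∀ (B₃ : ℝ), 4 < B₃ → ∃ a₁' O₁ : ℝ, 0 < a₁' ∧ 1 ≤ O₁ ∧
      ∀ (F : T3Family), F.L = L → ∀ (n K : ℕ) (hnK : n < K) (ε₁ : ℝ), 0 < ε₁ →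
        ∀ V : GaugeField (F.P n) 0 (Matrix.specialUnitaryGroup (Fin 2) ℂ), PlaqSmall ε₁ V →
          ∀ U₀ : GaugeField (F.P K) 0 (Matrix.specialUnitaryGroup (Fin 2) ℂ), RegPr F n K ((L : ℝ) ^ 3 * B₃ * ε₁) U₀ → U₀ ∈ fibre F ℰp n K hnK.le V →
            ε₁ ≤ a₁' → ∃ U ∈ regFibrePr F n K hnK.le (O₁ * (L : ℝ) ^ 3 * B₃ * ε₁) V,
              IsMinOn (fun W : GaugeField (F.P K) 0 (Matrix.specialUnitaryGroup (Fin 2) ℂ) => wilsonAction4 W)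
                (regFibrePr F n K hnK.le (O₁ * (L : ℝ) ^ 3 * B₃ * ε₁) V) U) :
    Summit.QuantumFields.YangMills.Theses.UnitScaleTilt.MinimiserStabilityRegPr := by
  intro L
  by_cases hL : 1 < L
  · obtain ⟨â₀, â₁, a₀, a₁, B₃, B₄, hâ₀, hâ₁, ha₀, ha₁, hB₃, hB₄, hatt, hIn8, hgrad⟩ := variational_of_halvingStep_of_existence hV2 hEX L hL
    -- EXIST
    obtain ⟨e₁, he₁, hE⟩ := hasRegMinimisersPrAt_of_attained hâ₀ hâ₁ hB₃ hatt
    -- UPPER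
    obtain ⟨C₁, C₂, c, hC₁, hC₂, hc, hlift⟩ := Summit.QuantumFields.YangMills.Theorems.SmoothLift.stub_smoothLift L
    obtain ⟨e₂, he₂, hU⟩ := upperAlongRegPrMinimisersAt_of_splitLog' ha₀ ha₁ hB₃ hB₄ hC₁ hC₂ hc hIn8 hgrad hlift
    -- LOWER
    obtain ⟨D₁, D₂, d, hD₁, hD₂, hd, havg⟩ := Summit.QuantumFields.YangMills.Theorems.AvgCurvGrad.stub_avgCurvGrad L
    obtain ⟨E₂, e, hE₂, he, hdef⟩ := Summit.QuantumFields.YangMills.Theorems.AvgActionDefect.stub_avgActionDefect L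
    obtain ⟨e₃, he₃, hLo⟩ := lowerAlongRegPrMinimisersAt_of_splitLog''' hL.le ha₀ ha₁ hB₃ hB₄ hD₂ hd hE₂ he hIn8 hgrad havg hdef
    -- the common `ε₁`, `m₀ = 10`, `γ₁`
    refine ⟨min e₁ (min e₂ e₃), lt_min he₁ (lt_min he₂ he₃), fun ε₀ hε hεle => ⟨10, fun m hm b₀ p₀ hb hp => ?_⟩⟩
    have hε₁ : ε₀ ≤ e₁ := hεle.trans (min_le_left _ _)
    have hε₂ : ε₀ ≤ e₂ := hεle.trans ((min_le_right _ _).trans (min_le_left _ _))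
    have hε₃ : ε₀ ≤ e₃ := hεle.trans ((min_le_right _ _).trans (min_le_right _ _))
    have hm2 : 2 ≤ m := le_trans (by norm_num) hm
    have hp0 : 0 < p₀ := lt_trans two_pos hp
    obtain ⟨γa, hγa, hA⟩ := hE ε₀ hε hε₁ m hm2 b₀ p₀ hb
    obtain ⟨γb, hγb, hB⟩ := hU ε₀ hε hε₂ m hm b₀ p₀ hb hp0
    obtain ⟨γc, hγc, hC⟩ := hLo ε₀ hε hε₃ m hm b₀ p₀ hb hp0
    refine ⟨min γa (min γb γc), lt_min hγa (lt_min hγb hγc), fun F γ hFL hγ hγle => ?_⟩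
    have hγa' : γ ≤ γa := hγle.trans (min_le_left _ _)
    have hγb' : γ ≤ γb := hγle.trans ((min_le_right _ _).trans (min_le_left _ _))
    have hγc' : γ ≤ γc := hγle.trans ((min_le_right _ _).trans (min_le_right _ _))
    exact minimiserStabilityRegPrAt_of_alongRegPrMinimisers hγ.le (hA F γ hFL hγ hγa') (hB F γ hFL hγ hγb') (hC F γ hFL hγ hγc')
  · -- no member of the family has block size `L ≤ 1`
    exact ⟨1, one_pos, fun ε₀ _ _ => ⟨0, fun m _ b₀ p₀ _ _ => ⟨1, one_pos, fun F γ hFL _ _ => absurd (hFL ▸ F.hL.2) hL⟩⟩⟩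

end Summit.QuantumFields.YangMills.Theorems.AttainmentOfExistence

end
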